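import Literature.NumberTheory.LFunctions.WeilMarkovQuadratic
import Literature.NumberTheory.LFunctions.WeilGroundState
import Literature.NumberTheory.LFunctions.WeilGroundStateRealZerosProofs
import Literature.NumberTheory.LFunctions.WeilWindowSuzukiProofs
import Literature.NumberTheory.LFunctions.WeilWindowSuzukiContinuityProofs
import Literature.NumberTheory.LFunctions.WeilSemilocalCompactnessProofs
import Literature.Analysis.FunctionSpaces.MollificationLp

/-!
# Stub `stub_formDomainPos` of line `cut-dont-squeeze` for crux `WeilWindowFlow.WindowLipschitz`
(item stmt-RiemannHypothesis-1039, route route-RiemannHypothesis-WeilWindowFlow; registered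
skeleton rev 4,
`Summits/RiemannHypothesis/RiemannHypothesis/Cruxes/WindowLipschitz/Lines/cut-dont-squeeze.lean`)

## What is proved

`stub_formDomainPos` (block C1): **test functions are dense from above in the form domain of the
window.** For `a > 0` and every `f ∈ L²(ℝ)` vanishing a.e. off `[-a, a]` with convergent
archimedean energy `∫₀^∞ e^{t/2}/(2 sinh t) D_t(f) dt`,
`(M_a + ε(a)) ‖f‖₂² ≤ P(f) + 𝓔_a(f)` (`ε(a) = weilGroundEnergy a`, `M_a = weilMarkovConstant a`,
`P = weilPoleForm`, `𝓔_a = weilDirichletEnergy a`, `D_t(f) = weilIncrement f t`). On smooth `f`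
supported in the window this is `ε(a)‖f‖² ≤ Re Q(f)` (`weilGroundEnergy_mul_le_re`) plus the
Markov decomposition `Re Q(f) = P(f) + 𝓔_a(f) − M_a‖f‖²`
(`weilQuadratic_re_eq_weilPoleForm_add_weilDirichletEnergy_sub`); the content is the extension to
the whole finite-energy class (`C_c^∞` of the window is a core of the closed form
`P + 𝓔_a − M_a‖·‖²`, Fukushima–Oshima–Takeda §1.1).

## Proof

Replace `f` by its truncation to `[-a, a]` (same a.e. class, same `‖f‖₂`, `P(f)`, `D_t(f)`).
Mollify, `gₙ = Kₙ ⋆ f` with normalised bumps `Kₙ` of outer radius `1/(n+1)` (Mathlib's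
`ContDiffBump.normed`, `MeasureTheory.convolution` for `lsmul ℝ ℝ`): `gₙ` is a test function on the
slightly LARGER window `bₙ = a + 1/(n+1)` (no rescaling is needed), so
`ε(bₙ)‖gₙ‖² ≤ P(gₙ) + 𝓔_{bₙ}(gₙ) − M_{bₙ}‖gₙ‖²`. Young's inequality with `‖Kₙ‖₁ = 1`
(`(Kₙ ⋆ f)(· + t) − Kₙ ⋆ f = Kₙ ⋆ (f(· + t) − f)`, the tree's
`Literature.Analysis.FunctionSpaces.eLpNorm_normed_convolution_le_haar`) gives `D_t(gₙ) ≤ D_t(f)`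
for all `t`, whence `𝓔_{bₙ}(gₙ) ≤ 𝓔_{bₙ}(f) = 𝓔_a(f) + (M_{bₙ} − M_a)‖f‖²` (the new prime lengths
`2a ≤ log m < 2bₙ` see a.e.-disjoint translates, `D_{log m}(f) = 2‖f‖²`). So
`ε(bₙ)‖gₙ‖² + M_a‖f‖² + M_{bₙ}(‖gₙ‖² − ‖f‖²) ≤ P(gₙ) + 𝓔_a(f)`, and `n → ∞`: `gₙ → f` in `L²`
(`Literature.Analysis.FunctionSpaces.tendsto_eLpNorm_normed_convolution_sub_self`), so
`‖gₙ‖² → ‖f‖²`, `P(gₙ) → P(f)` (`L²`-pairings with `cosh(x/2)`, `sinh(x/2)` cut off to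
`[-a-1, a+1]`); `M_{bₙ}` is monotone in the window hence bounded; `ε(bₙ) → ε(a)` by the continuity
of the ground energy (`continuousAt_weilGroundEnergy`, Suzuki 2026 Thm. 1.3).

## References

* M. Fukushima, Y. Oshima, M. Takeda, *Dirichlet Forms and Symmetric Markov Processes*,
  de Gruyter (2011), §1.1 and Example 1.4.1 (`C_c^∞` is a core of translation-invariant jump
  forms).
* P. A. Feulefack, S. Jarohs, T. Weth, arXiv:2010.10448, §3 p. 6 (`C_c^2` is dense in the form
  domain of the logarithmic Laplacian; the same mollification argument).
* M. Suzuki, *Weil's quadratic form via the screw function*, arXiv:2606.09096, Thm. 1.3.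
* E. Bombieri, *Remarks on Weil's quadratic functional in the theory of prime numbers I*, Rend.
  Mat. Acc. Lincei (9) 11 (2000), 183–233, Thm 2 and §4.
-/

set_option linter.dupNamespace false

noncomputable section

open MeasureTheory Set Filter ContinuousLinearMap
open scoped Topology ENNReal NNReal ComplexConjugate Convolution ArithmeticFunction.vonMangoldt

namespace Summit.RiemannHypothesis.RiemannHypothesis.Theorems.WeilWindowFlowWindowLipschitz

open Literature.NumberTheory.LFunctions Literature.NumberTheory.LFunctions.ConnesVanSuijlekom

/-! ## Increments of a window function at large shifts; energies of nested windows -/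

/-- For `f` vanishing off `[-a, a]` and a shift `t ≥ 2a` the translate `f(· + t)` and `f` have
(a.e.) disjoint supports, so `D_t(f) = 2‖f‖₂²`. [folklore] -/
private theorem weilIncrement_eq_two_mul {a : ℝ} {f : ℝ → ℂ} (hf : MemLp f 2)
    (hfs : ∀ x, x ∉ Icc (-a) a → f x = 0) {t : ℝ} (ht : 2 * a ≤ t) :
    weilIncrement f t = 2 * ∫ x, ‖f x‖ ^ 2 := by
  have h2 : Integrable fun x : ℝ ↦ ‖f x‖ ^ 2 := (memLp_two_iff_integrable_sq_norm hf.1).1 hf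
  have h2' : Integrable fun x : ℝ ↦ ‖f (x + t)‖ ^ 2 := h2.comp_add_right t
  have hae : (fun x : ℝ ↦ ‖f (x + t) - f x‖ ^ 2) =ᵐ[volume]
      fun x ↦ ‖f (x + t)‖ ^ 2 + ‖f x‖ ^ 2 := by
    filter_upwards [Measure.ae_ne volume (-a)] with x hx
    rcases lt_or_gt_of_ne hx with hlt | hgt
    · have h0 : f x = 0 := hfs x fun hm ↦ by linarith [hm.1]
      simp [h0]
    · have h0 : f (x + t) = 0 := hfs (x + t) fun hm ↦ by linarith [hm.2]
      simp [h0]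
  rw [weilIncrement, integral_congr_ae hae, integral_add h2' h2,
    integral_add_right_eq_self (fun x : ℝ ↦ ‖f x‖ ^ 2) t]
  ring

/-- The prime index sets are monotone in the window. [folklore] -/
private theorem weilPrimeIndex_mono {a b : ℝ} (hab : a ≤ b) :
    weilPrimeIndex a ⊆ weilPrimeIndex b :=
  fun _ hn ↦ mem_weilPrimeIndex.2 (lt_of_lt_of_le (mem_weilPrimeIndex.1 hn) (by linarith))

/-- The killing constant `M_a` is monotone in the window. [folklore] -/
private theorem weilMarkovConstant_mono {a b : ℝ} (hab : a ≤ b) :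
    weilMarkovConstant a ≤ weilMarkovConstant b := by
  unfold weilMarkovConstant
  have h := Finset.sum_le_sum_of_subset_of_nonneg (f := fun n : ℕ ↦ (Λ n : ℝ) / Real.sqrt n)
    (weilPrimeIndex_mono hab) fun n _ _ ↦
      div_nonneg ArithmeticFunction.vonMangoldt_nonneg (Real.sqrt_nonneg _)
  linarith

/-- Enlarging the window from `a` to `b ≥ a` adds to the energy of a function living on `[-a, a]`
exactly the new prime lengths `2a ≤ log n < 2b`, each with the saturated increment `2‖f‖₂²`:
`𝓔_b(f) = 𝓔_a(f) + (M_b − M_a)‖f‖₂²`. [folklore] -/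
private theorem weilDirichletEnergy_window {a b : ℝ} (hab : a ≤ b) {f : ℝ → ℂ} (hf : MemLp f 2)
    (hfs : ∀ x, x ∉ Icc (-a) a → f x = 0) :
    weilDirichletEnergy b f = weilDirichletEnergy a f +
      (weilMarkovConstant b - weilMarkovConstant a) * ∫ x, ‖f x‖ ^ 2 := by
  set N : ℝ := ∫ x, ‖f x‖ ^ 2
  have hsub := weilPrimeIndex_mono hab
  have hD : ∀ n ∈ weilPrimeIndex b \ weilPrimeIndex a,
      (Λ n : ℝ) / Real.sqrt n * weilIncrement f (Real.log n) =
        (Λ n : ℝ) / Real.sqrt n * (2 * N) := by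
    intro n hn
    rw [Finset.mem_sdiff, mem_weilPrimeIndex, mem_weilPrimeIndex, not_lt] at hn
    rw [weilIncrement_eq_two_mul hf hfs hn.2]
  have h1 := Finset.sum_sdiff hsub
    (f := fun n : ℕ ↦ (Λ n : ℝ) / Real.sqrt n * weilIncrement f (Real.log n))
  have h2 := Finset.sum_sdiff hsub (f := fun n : ℕ ↦ (Λ n : ℝ) / Real.sqrt n)
  rw [Finset.sum_congr rfl hD, ← Finset.sum_mul] at h1
  unfold weilDirichletEnergy weilMarkovConstant
  rw [← h1, ← h2]
  ring

/-! ## Mollification contracts increments -/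

/-- **Mollification contracts increments.** For the normalised bump kernel `K = φ.normed` and
`f ∈ L²`, `D_t(K ⋆ f) ≤ D_t(f)` for every `t`: the increment `(K ⋆ f)(· + t) − K ⋆ f` is
`K ⋆ (f(· + t) − f)`, and Young's inequality with `‖K‖₁ = 1` contracts `L²` norms. [folklore] -/
private theorem weilIncrement_mollify_le (φ : ContDiffBump (0 : ℝ)) {f : ℝ → ℂ} (hf : MemLp f 2)
    (t : ℝ) :
    weilIncrement (φ.normed volume ⋆[lsmul ℝ ℝ, volume] f) t ≤ weilIncrement f t := by
  set K : ℝ → ℝ := φ.normed volume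
  set h : ℝ → ℂ := fun y ↦ f (y + t) - f y with hh
  have hfl : LocallyIntegrable f volume := hf.locallyIntegrable one_le_two
  have hhm : MemLp h 2 volume :=
    (hf.comp_measurePreserving (measurePreserving_add_right volume t)).sub hf
  -- the increment of `K ⋆ f` at `t` is `K ⋆ h`
  have hpt : ∀ x, (K ⋆[lsmul ℝ ℝ, volume] f) (x + t) - (K ⋆[lsmul ℝ ℝ, volume] f) x =
      (K ⋆[lsmul ℝ ℝ, volume] h) x := by
    intro x
    have e1 := ((φ.hasCompactSupport_normed (μ := volume)).convolutionExists_left (lsmul ℝ ℝ)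
      φ.continuous_normed hfl (x + t)).integrable
    have e2 := ((φ.hasCompactSupport_normed (μ := volume)).convolutionExists_left (lsmul ℝ ℝ)
      φ.continuous_normed hfl x).integrable
    simp only [lsmul_apply] at e1 e2
    simp only [convolution_lsmul]
    rw [← integral_sub e1 e2]
    refine integral_congr_ae (Eventually.of_forall fun s ↦ ?_)
    simp only [hh, smul_sub]
    congr 3
    ring
  have hKh : MemLp (K ⋆[lsmul ℝ ℝ, volume] h) 2 volume :=
    Literature.Analysis.UnboundedOperators.memLp_convolution_lsmul φ.integrable_normed hhm
      one_le_two
  have hY := Literature.Analysis.FunctionSpaces.eLpNorm_normed_convolution_le_haar (μ := volume)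
    φ hhm.1 one_le_two
  rw [eLpNorm_two_eq_ofReal_sqrt hKh, eLpNorm_two_eq_ofReal_sqrt hhm,
    ENNReal.ofReal_le_ofReal_iff (Real.sqrt_nonneg _),
    Real.sqrt_le_sqrt_iff (integral_nonneg fun _ ↦ by positivity)] at hY
  have hlhs : weilIncrement (K ⋆[lsmul ℝ ℝ, volume] f) t =
      ∫ x, ‖(K ⋆[lsmul ℝ ℝ, volume] h) x‖ ^ 2 := by
    unfold weilIncrement
    simp_rw [hpt]
  rw [hlhs, weilIncrement]
  exact hY

/-- **Mollified approximants of a window function.** For `f ∈ L²` vanishing off `[-a, a]` the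
mollifications `gₙ = Kₙ ⋆ f` by normalised bumps of outer radius `1/(n+1)` are test functions
supported in `[-(a + 1/(n+1)), a + 1/(n+1)]`, have increments `D_t(gₙ) ≤ D_t(f)` for every `t`,
and converge to `f` in `L²`. [folklore] -/
private theorem exists_mollified_seq {a : ℝ} {f : ℝ → ℂ} (hf : MemLp f 2)
    (hfs : ∀ x, x ∉ Icc (-a) a → f x = 0) :
    ∃ g : ℕ → ℝ → ℂ,
      (∀ n, IsWeilTest (g n)) ∧
      (∀ n, tsupport (g n) ⊆ Icc (-(a + 1 / ((n : ℝ) + 1))) (a + 1 / ((n : ℝ) + 1))) ∧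
      (∀ n t, weilIncrement (g n) t ≤ weilIncrement f t) ∧
      Tendsto (fun n ↦ ∫ x, ‖g n x - f x‖ ^ 2) atTop (𝓝 0) := by
  set φ : ℕ → ContDiffBump (0 : ℝ) := fun n ↦
    ⟨1 / ((n : ℝ) + 2), 1 / ((n : ℝ) + 1), by positivity,
      one_div_lt_one_div_of_lt (by positivity) (by linarith)⟩
  have hrOut : ∀ n, (φ n).rOut = 1 / ((n : ℝ) + 1) := fun n ↦ rfl
  have hfl : LocallyIntegrable f volume := hf.locallyIntegrable one_le_two
  have hfc : HasCompactSupport f := HasCompactSupport.intro isCompact_Icc hfs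
  have hmem : ∀ n, MemLp ((φ n).normed volume ⋆[lsmul ℝ ℝ, volume] f) 2 volume := fun n ↦
    Literature.Analysis.UnboundedOperators.memLp_convolution_lsmul (φ n).integrable_normed hf
      one_le_two
  refine ⟨fun n ↦ (φ n).normed volume ⋆[lsmul ℝ ℝ, volume] f, fun n ↦ ⟨?_, ?_⟩, fun n ↦ ?_,
    fun n t ↦ weilIncrement_mollify_le (φ n) hf t, ?_⟩
  · exact ((φ n).hasCompactSupport_normed (μ := volume)).contDiff_convolution_left _
      (φ n).contDiff_normed hfl
  · exact ((φ n).hasCompactSupport_normed (μ := volume)).convolution _ hfc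
  · refine closure_minimal (fun x hx ↦ ?_) isClosed_Icc
    obtain ⟨y, hy, z, hz, rfl⟩ := support_convolution_subset (L := lsmul ℝ ℝ) (μ := volume)
      (f := (φ n).normed volume) (g := f) hx
    rw [(φ n).support_normed_eq, hrOut, Metric.mem_ball, dist_zero_right, Real.norm_eq_abs,
      abs_lt] at hy
    have hz' : z ∈ Icc (-a) a := not_not.1 fun h ↦ hz (hfs z h)
    constructor <;> linarith [hz'.1, hz'.2, hy.1, hy.2]
  · have hT := Literature.Analysis.FunctionSpaces.tendsto_eLpNorm_normed_convolution_sub_self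
      (μ := volume) (φ := φ) (l := atTop)
      (tendsto_one_div_add_atTop_nhds_zero_nat (𝕜 := ℝ)) one_le_two ENNReal.ofNat_ne_top hf
    have hT' : Tendsto (fun n ↦ Real.sqrt
        (∫ x, ‖((φ n).normed volume ⋆[lsmul ℝ ℝ, volume] f) x - f x‖ ^ 2)) atTop (𝓝 0) := by
      have h2 := (ENNReal.tendsto_toReal ENNReal.zero_ne_top).comp hT
      rw [ENNReal.toReal_zero] at h2
      refine h2.congr fun n ↦ ?_
      rw [Function.comp_apply, eLpNorm_two_eq_ofReal_sqrt ((hmem n).sub hf),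
        ENNReal.toReal_ofReal (Real.sqrt_nonneg _)]
      rfl
    have h3 := hT'.pow 2
    rw [zero_pow two_ne_zero] at h3
    refine h3.congr fun n ↦ ?_
    exact Real.sq_sqrt (integral_nonneg fun _ ↦ by positivity)

/-! ## Continuity of the pole form along `L²`-convergent window sequences -/

/-- Pairings with a continuous real weight converge along an `L²`-convergent sequence of
functions living on a fixed window (the weight is square integrable there). [folklore] -/
private theorem tendsto_integral_mul_ofReal {R : ℝ} {f : ℝ → ℂ} {g : ℕ → ℝ → ℂ}
    (hf : MemLp f 2) (hg : ∀ n, MemLp (g n) 2) (hfR : ∀ x, x ∉ Icc (-R) R → f x = 0)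
    (hgR : ∀ n x, x ∉ Icc (-R) R → g n x = 0)
    (hlim : Tendsto (fun n ↦ ∫ x, ‖g n x - f x‖ ^ 2) atTop (𝓝 0)) {w : ℝ → ℝ}
    (hw : Continuous w) :
    Tendsto (fun n ↦ ∫ x, g n x * (w x : ℂ)) atTop (𝓝 (∫ x, f x * (w x : ℂ))) := by
  set u : ℝ → ℂ := (Icc (-R) R).indicator fun x ↦ ((w x : ℝ) : ℂ) with hu
  have hwc : Continuous fun x : ℝ ↦ ((w x : ℝ) : ℂ) := Complex.continuous_ofReal.comp hw
  obtain ⟨C, hC⟩ := (isCompact_Icc (a := -R) (b := R)).exists_bound_of_continuousOn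
    hwc.continuousOn
  have hum : MemLp u 2 volume := by
    rw [hu, memLp_indicator_iff_restrict measurableSet_Icc]
    exact MemLp.of_bound hwc.aestronglyMeasurable C
      ((ae_restrict_iff' measurableSet_Icc).2 (Eventually.of_forall hC))
  have key : ∀ v : ℝ → ℂ, (∀ x, x ∉ Icc (-R) R → v x = 0) →
      (fun x ↦ v x * (w x : ℂ)) = fun x ↦ v x * conj (u x) := by
    intro v hv
    funext x
    by_cases hx : x ∈ Icc (-R) R
    · rw [hu, indicator_of_mem hx, Complex.conj_ofReal]
    · rw [hv x hx, zero_mul, zero_mul]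
  have hgk : (fun n ↦ ∫ x, g n x * (w x : ℂ)) = fun n ↦ ∫ x, g n x * conj (u x) :=
    funext fun n ↦ by rw [key (g n) (hgR n)]
  rw [hgk, key f hfR]
  exact tendsto_integral_mul_conj_left hum hf hg hlim

/-- **The pole form is continuous along `L²`-convergent sequences on a fixed window** (its two
integrals are `L²`-pairings with `cosh(x/2)`, `sinh(x/2)` cut off to the window). [folklore] -/
private theorem tendsto_weilPoleForm {R : ℝ} {f : ℝ → ℂ} {g : ℕ → ℝ → ℂ} (hf : MemLp f 2)
    (hg : ∀ n, MemLp (g n) 2) (hfR : ∀ x, x ∉ Icc (-R) R → f x = 0)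
    (hgR : ∀ n x, x ∉ Icc (-R) R → g n x = 0)
    (hlim : Tendsto (fun n ↦ ∫ x, ‖g n x - f x‖ ^ 2) atTop (𝓝 0)) :
    Tendsto (fun n ↦ weilPoleForm (g n)) atTop (𝓝 (weilPoleForm f)) := by
  have hc := tendsto_integral_mul_ofReal hf hg hfR hgR hlim
    (w := fun x ↦ Real.cosh (x / 2)) (by fun_prop)
  have hs := tendsto_integral_mul_ofReal hf hg hfR hgR hlim
    (w := fun x ↦ Real.sinh (x / 2)) (by fun_prop)
  unfold weilPoleForm
  exact ((hc.norm.pow 2).const_mul 2).sub ((hs.norm.pow 2).const_mul 2)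

/-! ## One step of the approximation and the limit -/

/-- **One step.** For a test function `g` on the window `[-b, b]`, `b ≥ a`, whose increments are
dominated by those of a finite-energy `f` living on `[-a, a]`:
`ε(b)‖g‖² + M_a‖f‖² + M_b(‖g‖² − ‖f‖²) ≤ P(g) + 𝓔_a(f)` (the variational inequality
`ε(b)‖g‖² ≤ Re Q(g)`, the Markov decomposition of `Re Q(g)` on `[-b, b]`, `𝓔_b(g) ≤ 𝓔_b(f)` and
`𝓔_b(f) = 𝓔_a(f) + (M_b − M_a)‖f‖²`). [folklore] -/
private theorem step_le {a b : ℝ} (hab : a ≤ b) {f g : ℝ → ℂ} (hf : MemLp f 2)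
    (hfs : ∀ x, x ∉ Icc (-a) a → f x = 0)
    (harch : IntegrableOn (fun t ↦ weilArchDensity t * weilIncrement f t) (Ioi 0))
    (hg : IsWeilTest g) (hgs : tsupport g ⊆ Icc (-b) b)
    (hD : ∀ t, weilIncrement g t ≤ weilIncrement f t) :
    weilGroundEnergy b * (∫ x, ‖g x‖ ^ 2) + weilMarkovConstant a * (∫ x, ‖f x‖ ^ 2) +
        weilMarkovConstant b * ((∫ x, ‖g x‖ ^ 2) - ∫ x, ‖f x‖ ^ 2) ≤
      weilPoleForm g + weilDirichletEnergy a f := by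
  have h1 := weilGroundEnergy_mul_le_re hg hgs
  have h2 := weilQuadratic_re_eq_weilPoleForm_add_weilDirichletEnergy_sub hg hgs
  have h3 : weilDirichletEnergy b g ≤ weilDirichletEnergy b f := by
    unfold weilDirichletEnergy
    refine add_le_add (Finset.sum_le_sum fun n _ ↦ mul_le_mul_of_nonneg_left (hD _)
      (div_nonneg ArithmeticFunction.vonMangoldt_nonneg (Real.sqrt_nonneg _))) ?_
    refine integral_mono_of_nonneg ?_ harch ?_
    · exact (ae_restrict_iff' measurableSet_Ioi).2 (Eventually.of_forall fun t ht ↦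
        mul_nonneg (weilArchDensity_pos ht).le (weilIncrement_nonneg _ t))
    · exact (ae_restrict_iff' measurableSet_Ioi).2 (Eventually.of_forall fun t ht ↦
        mul_le_mul_of_nonneg_left (hD t) (weilArchDensity_pos ht).le)
  have h4 := weilDirichletEnergy_window hab hf hfs
  rw [sub_mul] at h4
  rw [mul_sub]
  linarith

/-- **The inequality for functions living on the window** (pointwise support hypothesis): the
limit `n → ∞` of `step_le` along the mollified approximants `exists_mollified_seq`. [folklore] -/
private theorem core_le {a : ℝ} (ha : 0 < a) {f : ℝ → ℂ} (hf : MemLp f 2)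
    (hfs : ∀ x, x ∉ Icc (-a) a → f x = 0)
    (harch : IntegrableOn (fun t ↦ weilArchDensity t * weilIncrement f t) (Ioi 0)) :
    (weilMarkovConstant a + weilGroundEnergy a) * ∫ x, ‖f x‖ ^ 2 ≤
      weilPoleForm f + weilDirichletEnergy a f := by
  obtain ⟨g, hg, hgs, hD, hlim⟩ := exists_mollified_seq hf hfs
  have hr0 : ∀ n : ℕ, (0 : ℝ) < 1 / ((n : ℝ) + 1) := fun n ↦ by positivity
  have hr1 : ∀ n : ℕ, 1 / ((n : ℝ) + 1) ≤ 1 := fun n ↦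
    div_le_one_of_le₀ (by linarith [n.cast_nonneg (α := ℝ)]) (by positivity)
  have hgm : ∀ n, MemLp (g n) 2 := fun n ↦ (hg n).memLp_two
  -- norms and pole forms converge
  have hN : Tendsto (fun n ↦ ∫ x, ‖g n x‖ ^ 2) atTop (𝓝 (∫ x, ‖f x‖ ^ 2)) :=
    tendsto_integral_norm_sq hf hgm hlim
  have hfR : ∀ x, x ∉ Icc (-(a + 1)) (a + 1) → f x = 0 := fun x hx ↦
    hfs x fun h ↦ hx (Icc_subset_Icc (by linarith) (by linarith) h)
  have hgR : ∀ n x, x ∉ Icc (-(a + 1)) (a + 1) → g n x = 0 := fun n x hx ↦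
    image_eq_zero_of_notMem_tsupport fun h ↦
      hx (Icc_subset_Icc (by linarith [hr1 n]) (by linarith [hr1 n]) (hgs n h))
  have hP : Tendsto (fun n ↦ weilPoleForm (g n)) atTop (𝓝 (weilPoleForm f)) :=
    tendsto_weilPoleForm hf hgm hfR hgR hlim
  -- windows and ground energies converge
  have hb : Tendsto (fun n : ℕ ↦ a + 1 / ((n : ℝ) + 1)) atTop (𝓝 a) := by
    have := (tendsto_const_nhds (x := a) (f := (atTop : Filter ℕ))).add
      (tendsto_one_div_add_atTop_nhds_zero_nat (𝕜 := ℝ))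
    rwa [add_zero] at this
  have hε : Tendsto (fun n : ℕ ↦ weilGroundEnergy (a + 1 / ((n : ℝ) + 1))) atTop
      (𝓝 (weilGroundEnergy a)) :=
    (continuousAt_weilGroundEnergy ha).tendsto.comp hb
  -- the killing constants stay bounded, so `M_{bₙ}(‖gₙ‖² − ‖f‖²) → 0`
  have hMB : ∀ n : ℕ, |weilMarkovConstant (a + 1 / ((n : ℝ) + 1))| ≤
      |weilMarkovConstant a| + |weilMarkovConstant (a + 1)| := fun n ↦ by
    have h1 := weilMarkovConstant_mono (show a ≤ a + 1 / ((n : ℝ) + 1) by linarith [hr0 n])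
    have h2 := weilMarkovConstant_mono (show a + 1 / ((n : ℝ) + 1) ≤ a + 1 by linarith [hr1 n])
    rcases abs_cases (weilMarkovConstant (a + 1 / ((n : ℝ) + 1))) with h | h <;>
    rcases abs_cases (weilMarkovConstant a) with h' | h' <;>
    rcases abs_cases (weilMarkovConstant (a + 1)) with h'' | h'' <;> linarith
  have hM : Tendsto (fun n : ℕ ↦ weilMarkovConstant (a + 1 / ((n : ℝ) + 1)) *
      ((∫ x, ‖g n x‖ ^ 2) - ∫ x, ‖f x‖ ^ 2)) atTop (𝓝 0) := by
    refine squeeze_zero_norm (fun n ↦ ?_)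
      (a := fun n ↦ (|weilMarkovConstant a| + |weilMarkovConstant (a + 1)|) *
        |(∫ x, ‖g n x‖ ^ 2) - ∫ x, ‖f x‖ ^ 2|) ?_
    · rw [norm_mul, Real.norm_eq_abs, Real.norm_eq_abs]
      exact mul_le_mul_of_nonneg_right (hMB n) (abs_nonneg _)
    · have := (tendsto_sub_nhds_zero_iff.2 hN).abs.const_mul
        (|weilMarkovConstant a| + |weilMarkovConstant (a + 1)|)
      simpa using this
  -- pass to the limit in the one-step inequality
  have hL := ((hε.mul hN).add (tendsto_const_nhds
    (x := weilMarkovConstant a * ∫ x, ‖f x‖ ^ 2) (f := (atTop : Filter ℕ)))).add hM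
  have hR := hP.add (tendsto_const_nhds (x := weilDirichletEnergy a f) (f := (atTop : Filter ℕ)))
  have key := le_of_tendsto_of_tendsto' hL hR fun n ↦
    step_le (show a ≤ a + 1 / ((n : ℝ) + 1) by linarith [hr0 n]) hf hfs harch (hg n) (hgs n)
      (hD n)
  rw [add_mul]
  linarith

/-- **`C_c^∞` is dense from above in the form domain of the window** (Fukushima–Oshima–Takeda,
§1.1, for the closed form `P + 𝓔_a − M_a‖·‖²`; here in the elementary shape needed by the line):
for every `f ∈ L²` vanishing a.e. off `[-a, a]` with finite archimedean energy,
`(M_a + ε(a))‖f‖₂² ≤ P(f) + 𝓔_a(f)`. Proof: replace `f` by its truncation to the window (same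
a.e. class, same `‖f‖₂`, `P`, `D_t`) and apply `core_le` (mollify into the window `a + 1/(n+1)`,
Young's inequality for the increments, `L²`-convergence of mollifiers, continuity of `ε`; see the
module docstring). -/
theorem stub_formDomainPos :
    ∀ a : ℝ, 0 < a → ∀ f : ℝ → ℂ, MemLp f 2 → (∀ᵐ x : ℝ, x ∉ Icc (-a) a → f x = 0) →
      IntegrableOn (fun t ↦ weilArchDensity t * weilIncrement f t) (Ioi 0) →
        (weilMarkovConstant a + weilGroundEnergy a) * ∫ x, ‖f x‖ ^ 2 ≤
          weilPoleForm f + weilDirichletEnergy a f := by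
  intro a ha f hf hz harch
  set f' : ℝ → ℂ := (Icc (-a) a).indicator f with hf'
  have hff' : f =ᵐ[volume] f' := by
    filter_upwards [hz] with x hx
    by_cases hm : x ∈ Icc (-a) a
    · rw [hf', indicator_of_mem hm]
    · rw [hf', indicator_of_notMem hm, hx hm]
  have hf'm : MemLp f' 2 := MemLp.ae_eq hff' hf
  have hf's : ∀ x, x ∉ Icc (-a) a → f' x = 0 := fun x hx ↦ indicator_of_notMem hx _
  have hN : ∫ x, ‖f x‖ ^ 2 = ∫ x, ‖f' x‖ ^ 2 :=
    integral_congr_ae (hff'.mono fun x hx ↦ by simp only [hx])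
  have hmul : ∀ w : ℝ → ℂ, ∫ t, f t * w t = ∫ t, f' t * w t := fun w ↦
    integral_congr_ae (hff'.mono fun x hx ↦ by simp only [hx])
  have hP : weilPoleForm f = weilPoleForm f' := by
    unfold weilPoleForm
    rw [hmul (fun t ↦ (Real.cosh (t / 2) : ℂ)), hmul (fun t ↦ (Real.sinh (t / 2) : ℂ))]
  have hD : weilIncrement f = weilIncrement f' := by
    funext t
    unfold weilIncrement
    refine integral_congr_ae ?_
    have htr : (fun x ↦ f (x + t)) =ᵐ[volume] fun x ↦ f' (x + t) :=
      (measurePreserving_add_right volume t).quasiMeasurePreserving.ae_eq_comp hff'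
    filter_upwards [hff', htr] with x h1 h2
    have h2' : f (x + t) = f' (x + t) := h2
    simp only [h1, h2']
  have hE : weilDirichletEnergy a f = weilDirichletEnergy a f' := by
    simp only [weilDirichletEnergy, hD]
  rw [hN, hP, hE]
  rw [hD] at harch
  exact core_le ha hf'm hf's harch

end Summit.RiemannHypothesis.RiemannHypothesis.Theorems.WeilWindowFlowWindowLipschitz

end
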